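import Summits.Ventures.HodgeRepro2.HostAPI.Carriers.AlgebraicGeometry.Motives.BettiRealization
import Summits.Ventures.HodgeRepro2.HostAPI.Util.ForallBinderLint
open HostAPI.Carriers

noncomputable section

open CategoryTheory AlgebraicGeometry

namespace HostAPI.Carriers.AlgebraicGeometry.HodgeTheory

section HodgeTheory

variable (X : Motives.SchemeOver ℂ)

abbrev complexBetti (i : ℕ) : ModuleCat.{0} ℂ :=
  HostAPI.Carriers.AlgebraicTopology.SingularHomology.singularCohomology ℂ ℂ (Motives.ComplexPoints X) i

abbrev complexBetti.restrictCompl (Z : Set X.left) (i : ℕ) :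
    complexBetti X i ⟶ HostAPI.Carriers.AlgebraicTopology.SingularHomology.singularCohomology ℂ ℂ (Motives.complexPointsCompl X Z) i :=
  HostAPI.Carriers.AlgebraicTopology.SingularHomology.singularCohomology.map ℂ ℂ
    (⟨Subtype.val, continuous_subtype_val⟩ : C(Motives.complexPointsCompl X Z, Motives.ComplexPoints X)) i

def supportedClasses (i r : ℕ) : Submodule ℂ (complexBetti X i) :=
  ⨆ (Z : Set X.left) (_ : IsClosed Z) (_ : ∀ z ∈ Z, (r : ℕ∞) ≤ Order.coheight z),
    LinearMap.ker (complexBetti.restrictCompl X Z i).hom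

abbrev algebraicClasses (p : ℕ) : Submodule ℂ (complexBetti X (2 * p)) :=
  supportedClasses X (2 * p) p

variable {X}

theorem mem_supportedClasses_of_restrictCompl_eq_zero {i r : ℕ} {Z : Set X.left} (hZ : IsClosed Z)
    (hr : ∀ z ∈ Z, (r : ℕ∞) ≤ Order.coheight z) {x : complexBetti X i}
    (hx : complexBetti.restrictCompl X Z i x = 0) : x ∈ supportedClasses X i r :=
  Submodule.mem_iSup_of_mem Z (Submodule.mem_iSup_of_mem hZ (Submodule.mem_iSup_of_mem hr hx))

variable (X) in

theorem supportedClasses_mono (i : ℕ) {r s : ℕ} (h : r ≤ s) :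
    supportedClasses X i s ≤ supportedClasses X i r := by
  refine iSup_mono fun Z ↦ iSup_mono fun _ ↦ iSup_le fun hs ↦ le_iSup_of_le (fun z hz ↦ ?_) le_rfl
  exact le_trans (by exact_mod_cast h) (hs z hz)

variable (X) in

theorem supportedClasses_zero (i : ℕ) : supportedClasses X i 0 = ⊤ := by
  refine eq_top_iff.2 fun x _ ↦ mem_supportedClasses_of_restrictCompl_eq_zero isClosed_univ
    (fun _ _ ↦ by simp) ?_
  haveI : IsEmpty (Motives.complexPointsCompl X Set.univ) := ⟨fun P ↦ P.2 (Set.mem_univ _)⟩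
  haveI := ModuleCat.subsingleton_of_isZero
    (Motives.isZero_singularCohomology_of_isEmpty ℂ ℂ (E := Motives.complexPointsCompl X Set.univ) i)
  exact Subsingleton.elim _ _

theorem algebraicClasses_zero : algebraicClasses X 0 = ⊤ :=
  supportedClasses_zero X _

end HodgeTheory

end HostAPI.Carriers.AlgebraicGeometry.HodgeTheory

end
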